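import Mathlib.Analysis.Complex.Liouville
import Mathlib.Analysis.Calculus.MeanValue
import HarnessLib

/-!
# Crux `BalabanStepParabolic`, line `horn-cauchy-lipschitz`: Cauchy estimates on sector/horn discs

Support file for crux stmt-QuantumFields-9684 (route `ParabolicTrajectory` of `YangMills`), line
`horn-cauchy-lipschitz`, stub 1 (`stub_cauchyConeLipschitz`): Cauchy estimates on the sector discs
`D(g, a|g|)` and horn discs `D(g, ρ g)` in the complexified coupling and on fibre discs in the ball
`‖w‖ < 4δ` of a complex Banach chart turn the SUP bounds of an analytically continued RG step
`(φc, Ψc)` into the three Lipschitz / remainder clauses of `BalabanBanachStep` (`remainder`,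
`lipschitz_fibre`, `lipschitz_base`) with their verbatim shapes, constant `C' = 8 C + C / a`.
Pure Mathlib complex analysis (`Complex.norm_deriv_le_of_forall_mem_sphere_norm_le` + the mean value
inequality on convex sets); generic helper lemmas first, then the stub.  No project definitions.
-/

noncomputable section

open Set Metric

namespace Summit.QuantumFields.YangMills.Theorems.BalabanStepParabolic

variable {F E : Type*} [NormedAddCommGroup F] [NormedSpace ℂ F] [NormedAddCommGroup E]
  [NormedSpace ℂ E]

/-- **Cauchy estimate for a Fréchet derivative.**  If `G` is complex-differentiable on an open
`s ⊇ closedBall w₀ r` (`r > 0`) with `‖G‖ ≤ M` on that ball, then `‖fderiv ℂ G w₀‖ ≤ M / r`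
(one-variable Cauchy estimate along the lines `t ↦ w₀ + t • x`, `|t| < r / ‖x‖`). [folklore] -/
theorem norm_fderiv_le_of_forall_closedBall_norm_le {G : F → E} {s : Set F} (hs : IsOpen s)
    (hG : DifferentiableOn ℂ G s) {w₀ : F} {r M : ℝ} (hr : 0 < r) (hball : closedBall w₀ r ⊆ s)
    (hM : ∀ ζ ∈ closedBall w₀ r, ‖G ζ‖ ≤ M) : ‖fderiv ℂ G w₀‖ ≤ M / r := by
  have hM0 : 0 ≤ M := (norm_nonneg _).trans (hM w₀ (mem_closedBall_self hr.le))
  refine ContinuousLinearMap.opNorm_le_bound _ (div_nonneg hM0 hr.le) fun x => ?_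
  rcases eq_or_ne x 0 with rfl | hx
  · simp
  have hxpos : 0 < ‖x‖ := norm_pos_iff.mpr hx
  set ℓ : ℂ → F := fun t => w₀ + t • x with hℓ
  have hRpos : 0 < r / ‖x‖ := div_pos hr hxpos
  have hmaps : MapsTo ℓ (closedBall 0 (r / ‖x‖)) (closedBall w₀ r) := fun t ht => by
    rw [mem_closedBall_zero_iff] at ht
    simp only [hℓ, mem_closedBall, dist_eq_norm, add_sub_cancel_left, norm_smul]
    calc ‖t‖ * ‖x‖ ≤ r / ‖x‖ * ‖x‖ := by gcongr
      _ = r := div_mul_cancel₀ r hxpos.ne'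
  have hℓd : Differentiable ℂ ℓ := fun t => (differentiableAt_id.smul_const x).const_add w₀
  have hdc : DiffContOnCl ℂ (G ∘ ℓ) (ball 0 (r / ‖x‖)) :=
    (hG.comp hℓd.differentiableOn (hmaps.mono_right hball)).diffContOnCl_ball Subset.rfl
  have hsph : ∀ t ∈ sphere (0 : ℂ) (r / ‖x‖), ‖(G ∘ ℓ) t‖ ≤ M := fun t ht =>
    hM _ (hmaps (sphere_subset_closedBall ht))
  have hGat : HasFDerivAt G (fderiv ℂ G w₀) w₀ :=
    (hG.differentiableAt (hs.mem_nhds (hball (mem_closedBall_self hr.le)))).hasFDerivAt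
  have hℓat : HasDerivAt ℓ x 0 := by
    simpa [hℓ] using ((hasDerivAt_id (0 : ℂ)).smul_const x).const_add w₀
  have key := Complex.norm_deriv_le_of_forall_mem_sphere_norm_le hRpos hdc hsph
  rw [(hGat.comp_hasDerivAt_of_eq 0 hℓat (by simp [hℓ])).deriv] at key
  calc ‖fderiv ℂ G w₀ x‖ ≤ M / (r / ‖x‖) := key
    _ = M / r * ‖x‖ := by rw [div_div_eq_mul_div, mul_div_right_comm]

/-- **Cauchy estimate from the oscillation on a disc.**  If `f : ℂ → E` is complex-differentiable on
an open `U ⊇ closedBall c R` (`R > 0`) and `‖f z - f c‖ ≤ B` on that closed disc, then `f` is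
differentiable at `c` with `‖deriv f c‖ ≤ B / R`. [folklore] -/
theorem differentiableAt_and_norm_deriv_le {f : ℂ → E} {U : Set ℂ} (hU : IsOpen U)
    (hf : DifferentiableOn ℂ f U) {c : ℂ} {R B : ℝ} (hR : 0 < R) (hcU : closedBall c R ⊆ U)
    (hB : ∀ z ∈ closedBall c R, ‖f z - f c‖ ≤ B) :
    DifferentiableAt ℂ f c ∧ ‖deriv f c‖ ≤ B / R := by
  refine ⟨hf.differentiableAt (hU.mem_nhds (hcU (mem_closedBall_self hR.le))), ?_⟩
  have h := Complex.norm_deriv_le_of_forall_mem_sphere_norm_le hR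
    ((hf.sub_const (f c)).diffContOnCl_ball hcU) (fun z hz => hB z (sphere_subset_closedBall hz))
  simpa only [deriv_sub_const] using h

/-- **Mean value inequality along a real segment in `ℂ`.**  If `f : ℂ → E` is complex-differentiable
at every point of `[[g, g']] ⊆ ℂ` with `‖deriv f‖ ≤ K` there, then `‖f g - f g'‖ ≤ K |g - g'|`.
[folklore] -/
theorem norm_sub_le_of_deriv_real_segment {f : ℂ → E} {g g' K : ℝ}
    (hf : ∀ t ∈ uIcc g g', DifferentiableAt ℂ f t) (hK : ∀ t ∈ uIcc g g', ‖deriv f t‖ ≤ K) :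
    ‖f g - f g'‖ ≤ K * |g - g'| := by
  have hs : Convex ℝ (((↑) : ℝ → ℂ) '' uIcc g g') :=
    (convex_uIcc g g').is_linear_image
      ⟨Complex.ofReal_add, fun c x => by rw [smul_eq_mul, Complex.ofReal_mul, Complex.real_smul]⟩
  have h1 : ∀ z ∈ ((↑) : ℝ → ℂ) '' uIcc g g', DifferentiableAt ℂ f z := by
    rintro z ⟨t, ht, rfl⟩
    exact hf t ht
  have h2 : ∀ z ∈ ((↑) : ℝ → ℂ) '' uIcc g g', ‖deriv f z‖ ≤ K := by
    rintro z ⟨t, ht, rfl⟩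
    exact hK t ht
  have key := hs.norm_image_sub_le_of_norm_deriv_le h1 h2
    (mem_image_of_mem _ right_mem_uIcc) (mem_image_of_mem _ left_mem_uIcc)
  rwa [← Complex.ofReal_sub, Complex.norm_real, Real.norm_eq_abs] at key

/-- **Fibre Lipschitz bound from a sup bound** (shape of the `φ`-clause).  If `G` is
complex-differentiable on `‖ζ‖ < 4δ` with `‖G ζ‖ ≤ K` for `‖ζ‖ ≤ 3δ`, then `G` is
`K / (2δ)`-Lipschitz on `‖w‖ ≤ δ` (Cauchy on fibre discs of radius `2δ`, then MVT). [folklore] -/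
theorem norm_sub_le_of_ball_sup {G : F → E} {δ K : ℝ} (hδ : 0 < δ)
    (hG : DifferentiableOn ℂ G (ball 0 (4 * δ))) (hK : ∀ ζ : F, ‖ζ‖ ≤ 3 * δ → ‖G ζ‖ ≤ K)
    {w w' : F} (hw : ‖w‖ ≤ δ) (hw' : ‖w'‖ ≤ δ) :
    ‖G w - G w'‖ ≤ K / (2 * δ) * ‖w - w'‖ := by
  have hdiff : ∀ y ∈ closedBall (0 : F) δ, DifferentiableAt ℂ G y := fun y hy => by
    rw [mem_closedBall_zero_iff] at hy
    exact hG.differentiableAt (isOpen_ball.mem_nhds (mem_ball_zero_iff.mpr (by linarith)))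
  have hbd : ∀ y ∈ closedBall (0 : F) δ, ‖fderiv ℂ G y‖ ≤ K / (2 * δ) := fun y hy => by
    rw [mem_closedBall_zero_iff] at hy
    refine norm_fderiv_le_of_forall_closedBall_norm_le isOpen_ball hG (by positivity)
      (fun ζ hζ => mem_ball_zero_iff.mpr ?_) (fun ζ hζ => hK ζ ?_)
    · linarith [norm_le_of_mem_closedBall hζ]
    · linarith [norm_le_of_mem_closedBall hζ]
  exact (convex_closedBall (0 : F) δ).norm_image_sub_le_of_norm_fderiv_le hdiff hbd
    (mem_closedBall_zero_iff.mpr hw') (mem_closedBall_zero_iff.mpr hw)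

/-- **Cauchy bound for the fibre derivative of a quadratically small map** (shape of the
`Ψ`-clause).  If `H` is complex-differentiable on `‖ζ‖ < 4δ` with `‖H ζ‖ ≤ C t (t + ‖ζ‖) + C ‖ζ‖²`
for `‖ζ‖ ≤ 3δ` (`0 ≤ t ≤ δ`), then `‖fderiv ℂ H x‖ ≤ 8 C (t + ‖x‖)` for `‖x‖ ≤ δ` (Cauchy on the
fibre disc of radius `(t + ‖x‖ + η) / 2` around `x`, then `η → 0`). [folklore] -/
theorem norm_fderiv_le_of_quadratic_sup {H : F → E} {δ C t : ℝ} (hδ : 0 < δ) (hC : 0 ≤ C)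
    (ht : 0 ≤ t) (htδ : t ≤ δ) (hH : DifferentiableOn ℂ H (ball 0 (4 * δ)))
    (hb : ∀ ζ : F, ‖ζ‖ ≤ 3 * δ → ‖H ζ‖ ≤ C * t * (t + ‖ζ‖) + C * ‖ζ‖ ^ 2)
    {x : F} (hx : ‖x‖ ≤ δ) : ‖fderiv ℂ H x‖ ≤ 8 * C * (t + ‖x‖) := by
  refine le_of_forall_pos_le_add fun ε hε => ?_
  obtain ⟨η, hη0, hηδ, hηε⟩ : ∃ η : ℝ, 0 < η ∧ η ≤ δ ∧ 8 * C * η ≤ ε :=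
    ⟨min δ (ε / (8 * C + 1)), lt_min hδ (by positivity), min_le_left _ _,
      calc 8 * C * min δ (ε / (8 * C + 1)) ≤ (8 * C + 1) * (ε / (8 * C + 1)) :=
            mul_le_mul (by linarith) (min_le_right _ _) (by positivity) (by positivity)
        _ = ε := mul_div_cancel₀ ε (by positivity)⟩
  obtain ⟨r, hr⟩ : ∃ r : ℝ, r = (t + ‖x‖ + η) / 2 := ⟨_, rfl⟩
  have hr0 : 0 < r := by rw [hr]; positivity
  have hxr : ‖x‖ + r ≤ 3 * δ := by rw [hr]; linarith
  have hsub : closedBall x r ⊆ ball (0 : F) (4 * δ) := fun ζ hζ =>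
    mem_ball_zero_iff.mpr (by linarith [norm_le_of_mem_closedBall hζ])
  have hM : ∀ ζ ∈ closedBall x r, ‖H ζ‖ ≤ C * t * (t + (‖x‖ + r)) + C * (‖x‖ + r) ^ 2 := by
    intro ζ hζ
    have h1 : ‖ζ‖ ≤ ‖x‖ + r := norm_le_of_mem_closedBall hζ
    calc ‖H ζ‖ ≤ C * t * (t + ‖ζ‖) + C * ‖ζ‖ ^ 2 := hb ζ (h1.trans hxr)
      _ ≤ C * t * (t + (‖x‖ + r)) + C * (‖x‖ + r) ^ 2 := by gcongr
  have key := norm_fderiv_le_of_forall_closedBall_norm_le isOpen_ball hH hr0 hsub hM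
  have hq : t * (t + (‖x‖ + r)) + (‖x‖ + r) ^ 2 ≤ 8 * (t + ‖x‖ + η) * r := by
    rw [hr]
    nlinarith [mul_nonneg ht (norm_nonneg x), mul_nonneg ht hη0.le,
      mul_nonneg (norm_nonneg x) hη0.le, sq_nonneg t, sq_nonneg ‖x‖, sq_nonneg η]
  calc ‖fderiv ℂ H x‖ ≤ (C * t * (t + (‖x‖ + r)) + C * (‖x‖ + r) ^ 2) / r := key
    _ = C * (t * (t + (‖x‖ + r)) + (‖x‖ + r) ^ 2) / r := by ring
    _ ≤ C * (8 * (t + ‖x‖ + η) * r) / r :=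
        div_le_div_of_nonneg_right (mul_le_mul_of_nonneg_left hq hC) hr0.le
    _ = 8 * C * (t + ‖x‖) + 8 * C * η := by field_simp
    _ ≤ 8 * C * (t + ‖x‖) + ε := by gcongr

/-- **Fibre Lipschitz bound modulo the linearisation** (shape of the `Ψ`-clause).  Under the
hypotheses of `norm_fderiv_le_of_quadratic_sup`, `‖H w - H w'‖ ≤ 8 C (t + ‖w‖ + ‖w'‖) ‖w - w'‖` on
`‖w‖ ≤ δ` (mean value inequality on the ball of radius `max ‖w‖ ‖w'‖`). [folklore] -/
theorem norm_sub_le_of_quadratic_sup {H : F → E} {δ C t : ℝ} (hδ : 0 < δ) (hC : 0 ≤ C)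
    (ht : 0 ≤ t) (htδ : t ≤ δ) (hH : DifferentiableOn ℂ H (ball 0 (4 * δ)))
    (hb : ∀ ζ : F, ‖ζ‖ ≤ 3 * δ → ‖H ζ‖ ≤ C * t * (t + ‖ζ‖) + C * ‖ζ‖ ^ 2)
    {w w' : F} (hw : ‖w‖ ≤ δ) (hw' : ‖w'‖ ≤ δ) :
    ‖H w - H w'‖ ≤ 8 * C * (t + ‖w‖ + ‖w'‖) * ‖w - w'‖ := by
  have hmδ : max ‖w‖ ‖w'‖ ≤ δ := max_le hw hw'
  have hm : max ‖w‖ ‖w'‖ ≤ ‖w‖ + ‖w'‖ := max_le_add_of_nonneg (norm_nonneg _) (norm_nonneg _)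
  have hdiff : ∀ y ∈ closedBall (0 : F) (max ‖w‖ ‖w'‖), DifferentiableAt ℂ H y := fun y hy => by
    rw [mem_closedBall_zero_iff] at hy
    exact hH.differentiableAt (isOpen_ball.mem_nhds (mem_ball_zero_iff.mpr (by linarith)))
  have hbd : ∀ y ∈ closedBall (0 : F) (max ‖w‖ ‖w'‖),
      ‖fderiv ℂ H y‖ ≤ 8 * C * (t + ‖w‖ + ‖w'‖) := fun y hy => by
    rw [mem_closedBall_zero_iff] at hy
    calc ‖fderiv ℂ H y‖ ≤ 8 * C * (t + ‖y‖) :=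
          norm_fderiv_le_of_quadratic_sup hδ hC ht htδ hH hb (hy.trans hmδ)
      _ ≤ 8 * C * (t + ‖w‖ + ‖w'‖) := mul_le_mul_of_nonneg_left (by linarith) (by positivity)
  exact (convex_closedBall (0 : F) _).norm_image_sub_le_of_norm_fderiv_le hdiff hbd
    (mem_closedBall_zero_iff.mpr (le_max_right _ _)) (mem_closedBall_zero_iff.mpr (le_max_left _ _))

/-- **Base Lipschitz bound from derivative bounds at nonzero real couplings.**  If `P : ℂ → E` is
complex-differentiable at every real `t ≠ 0`, `|t| ≤ δ`, with `‖deriv P t‖ ≤ K |t|^k (|t| + n)`, and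
`‖P t - P 0‖ ≤ K |t|^k (|t| + n) |t|` for `|t| ≤ δ`, then `‖P g - P g'‖ ≤ K m^k (m + n) |g - g'|`
for `|g|, |g'| ≤ δ`, `m = max |g| |g'|` (mean value inequality on `[g, g']` when it avoids `0`,
triangle inequality through `0` otherwise). [folklore] -/
theorem norm_sub_le_of_real_couplings {P : ℂ → E} {δ K n : ℝ} {k : ℕ} (hK : 0 ≤ K) (hn : 0 ≤ n)
    (hderiv : ∀ t : ℝ, t ≠ 0 → |t| ≤ δ →
      DifferentiableAt ℂ P t ∧ ‖deriv P t‖ ≤ K * |t| ^ k * (|t| + n))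
    (hend : ∀ t : ℝ, |t| ≤ δ → ‖P t - P 0‖ ≤ K * |t| ^ k * (|t| + n) * |t|)
    {g g' : ℝ} (hg : |g| ≤ δ) (hg' : |g'| ≤ δ) :
    ‖P g - P g'‖ ≤ K * max |g| |g'| ^ k * (max |g| |g'| + n) * |g - g'| := by
  have hgm : |g| ≤ max |g| |g'| := le_max_left _ _
  have hg'm : |g'| ≤ max |g| |g'| := le_max_right _ _
  have hmδ : max |g| |g'| ≤ δ := max_le hg hg'
  by_cases h0 : (0 : ℝ) ∈ uIcc g g'
  · -- through the origin: `|g - g'| = |g| + |g'|`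
    have habs : |g - g'| = |g| + |g'| := by
      rcases mem_uIcc.mp h0 with ⟨h1, h2⟩ | ⟨h1, h2⟩
      · rw [abs_of_nonpos (by linarith), abs_of_nonpos h1, abs_of_nonneg h2]; ring
      · rw [abs_of_nonneg (by linarith), abs_of_nonneg h2, abs_of_nonpos h1]; ring
    have key : ∀ t : ℝ, |t| ≤ δ → |t| ≤ max |g| |g'| →
        ‖P t - P 0‖ ≤ K * max |g| |g'| ^ k * (max |g| |g'| + n) * |t| := fun t htδ htm =>
      calc ‖P t - P 0‖ ≤ K * |t| ^ k * (|t| + n) * |t| := hend t htδ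
        _ ≤ K * max |g| |g'| ^ k * (max |g| |g'| + n) * |t| := by gcongr
    calc ‖P g - P g'‖ = ‖(P g - P 0) - (P g' - P 0)‖ := by rw [sub_sub_sub_cancel_right]
      _ ≤ ‖P g - P 0‖ + ‖P g' - P 0‖ := norm_sub_le _ _
      _ ≤ K * max |g| |g'| ^ k * (max |g| |g'| + n) * |g| +
            K * max |g| |g'| ^ k * (max |g| |g'| + n) * |g'| :=
          add_le_add (key g hg hgm) (key g' hg' hg'm)
      _ = K * max |g| |g'| ^ k * (max |g| |g'| + n) * |g - g'| := by rw [habs]; ring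
  · -- same strict sign: mean value inequality along the real segment
    have hseg : ∀ t ∈ uIcc g g', t ≠ 0 ∧ |t| ≤ max |g| |g'| := by
      intro t ht
      refine ⟨fun h => h0 (h ▸ ht), ?_⟩
      rcases mem_uIcc.mp ht with ⟨h1, h2⟩ | ⟨h1, h2⟩
      · exact abs_le_max_abs_abs h1 h2
      · exact (abs_le_max_abs_abs h1 h2).trans_eq (max_comm _ _)
    refine norm_sub_le_of_deriv_real_segment
      (fun t ht => (hderiv t (hseg t ht).1 ((hseg t ht).2.trans hmδ)).1) (fun t ht => ?_)
    obtain ⟨ht0, htm⟩ := hseg t ht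
    calc ‖deriv P t‖ ≤ K * |t| ^ k * (|t| + n) := (hderiv t ht0 (htm.trans hmδ)).2
      _ ≤ K * max |g| |g'| ^ k * (max |g| |g'| + n) := by gcongr

/-- Even powers ignore signs: `t ^ 4 = |t| ^ 4`. [folklore] -/
private theorem pow_four_eq_abs_pow_four (t : ℝ) : t ^ 4 = |t| ^ 4 :=
  (Even.pow_abs ⟨2, rfl⟩ t).symm

/-- **Stub `stub_cauchyConeLipschitz` of line `horn-cauchy-lipschitz` (crux `BalabanStepParabolic`,
stmt-QuantumFields-9684).**  Cauchy estimates on a cone of discs: if the remainder pieces of a split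
`φc = z + b z³ + ρ₁s + ρ₁l`, `Ψc = Ψs + Ψl` are complex-differentiable in `z` on an open set
containing the sector discs `D(g, a|g|)` and the horn discs `D(g, ρ g)` for all real `0 < |g| ≤ δ`,
the totals are complex-differentiable in `w` on `‖w‖ < 4δ`, and the SUP bounds (`sup_real`,
`sup_sector`, `sup_horn` shapes) hold, then the three Lipschitz / remainder clauses of
`BalabanBanachStep` hold on real couplings `|g| ≤ δ` and the chart ball `‖w‖ ≤ δ`, verbatim shapes,
`C' = 8 C + C / a` (couplings of opposite signs are joined through `g = 0`). [folklore] -/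
theorem stub_cauchyConeLipschitz :
    ∀ (F : Type) [NormedAddCommGroup F] [NormedSpace ℂ F] [CompleteSpace F]
      (φc : ℂ → F → ℂ) (Ψc : ℂ → F → F) (ρ₁s ρ₁l : ℂ → F → ℂ) (Ψs Ψl : ℂ → F → F)
      (Ac : F →L[ℂ] F) (b C δ a : ℝ) (ρ : ℝ → ℝ) (U : Set ℂ),
      0 < C → 0 < δ → 0 < a → IsOpen U →
      (∀ (z : ℂ) (w : F), φc z w = z + b * z ^ 3 + ρ₁s z w + ρ₁l z w) →
      (∀ (z : ℂ) (w : F), Ψc z w = Ψs z w + Ψl z w) →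
      (∀ g : ℝ, g ≠ 0 → |g| ≤ δ →
        0 < ρ g ∧ Metric.closedBall (g : ℂ) (a * |g|) ⊆ U ∧ Metric.closedBall (g : ℂ) (ρ g) ⊆ U) →
      (∀ w : F, ‖w‖ ≤ δ →
        DifferentiableOn ℂ (fun z => ρ₁s z w) U ∧ DifferentiableOn ℂ (fun z => ρ₁l z w) U ∧
          DifferentiableOn ℂ (fun z => Ψs z w) U ∧ DifferentiableOn ℂ (fun z => Ψl z w) U) →
      (∀ g : ℝ, |g| ≤ δ →
        DifferentiableOn ℂ (fun w => φc g w) (Metric.ball (0 : F) (4 * δ)) ∧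
          DifferentiableOn ℂ (fun w => Ψc g w) (Metric.ball (0 : F) (4 * δ))) →
      (∀ g : ℝ, |g| ≤ δ → ∀ w : F, ‖w‖ ≤ 3 * δ →
        ‖φc g w - ((g + b * g ^ 3 : ℝ) : ℂ)‖ ≤ C * (g ^ 4 + |g| ^ 3 * ‖w‖) ∧
          ‖Ψc g w - Ψc 0 w‖ ≤ C * |g| * (|g| + ‖w‖) ∧ ‖Ψc 0 w - Ac w‖ ≤ C * ‖w‖ ^ 2) →
      (∀ g : ℝ, g ≠ 0 → |g| ≤ δ → ∀ z ∈ Metric.closedBall (g : ℂ) (a * |g|),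
        ∀ w : F, ‖w‖ ≤ δ →
          ‖ρ₁s z w - ρ₁s g w‖ ≤ C * (g ^ 4 + |g| ^ 3 * ‖w‖) ∧
            ‖Ψs z w - Ψs g w‖ ≤ C * |g| * (|g| + ‖w‖)) →
      (∀ g : ℝ, g ≠ 0 → |g| ≤ δ → ∀ z ∈ Metric.closedBall (g : ℂ) (ρ g),
        ∀ w : F, ‖w‖ ≤ δ →
          ‖ρ₁l z w - ρ₁l g w‖ ≤ C * ρ g * g ^ 2 * (|g| + ‖w‖) ∧
            ‖Ψl z w - Ψl g w‖ ≤ C * ρ g * (|g| + ‖w‖)) →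
      ∃ C' : ℝ, 0 < C' ∧
        (∀ (g : ℝ) (w : F), |g| ≤ δ → ‖w‖ ≤ δ →
          ‖φc g w - ((g + b * g ^ 3 : ℝ) : ℂ)‖ ≤ C' * (g ^ 4 + |g| ^ 3 * ‖w‖) ∧
            ‖Ψc g w - Ac w‖ ≤ C' * (g ^ 2 + ‖w‖ ^ 2)) ∧
        (∀ (g : ℝ) (w w' : F), |g| ≤ δ → ‖w‖ ≤ δ → ‖w'‖ ≤ δ →
          ‖φc g w - φc g w'‖ ≤ C' * |g| ^ 3 * ‖w - w'‖ ∧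
            ‖Ψc g w - Ψc g w' - Ac (w - w')‖ ≤ C' * (|g| + ‖w‖ + ‖w'‖) * ‖w - w'‖) ∧
        (∀ (g g' : ℝ) (w : F), |g| ≤ δ → |g'| ≤ δ → ‖w‖ ≤ δ →
          ‖φc g w - φc g' w - (((g - g') + b * (g ^ 3 - g' ^ 3) : ℝ) : ℂ)‖ ≤
              C' * (max |g| |g'|) ^ 2 * (max |g| |g'| + ‖w‖) * |g - g'| ∧
            ‖Ψc g w - Ψc g' w‖ ≤ C' * (|g| + |g'| + ‖w‖) * |g - g'|) := by
  intro F _ _ _ φc Ψc ρ₁s ρ₁l Ψs Ψl Ac b C δ a ρ U hC hδ ha hU hφ hΨ hdiscs hcoup hfib hsup hsec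
    hhorn
  have hC0 : 0 ≤ C := hC.le
  have hCa : 0 ≤ C / a := div_nonneg hC0 ha.le
  have hKC : C ≤ C / a + C := by linarith
  have hK' : C / a + C ≤ 8 * C + C / a := by linarith
  have hφ0 : ∀ w : F, ‖w‖ ≤ 3 * δ → φc 0 w = 0 := fun w hw => by
    simpa using (hsup 0 (by simp [hδ.le]) w hw).1
  refine ⟨8 * C + C / a, by positivity, ?_, ?_, ?_⟩
  · intro g w hg hw
    have hw3 : ‖w‖ ≤ 3 * δ := by linarith [norm_nonneg w]
    obtain ⟨h1, h2, h3⟩ := hsup g hg w hw3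
    refine ⟨h1.trans (mul_le_mul_of_nonneg_right (by linarith) (by positivity)), ?_⟩
    calc ‖Ψc g w - Ac w‖ ≤ ‖Ψc g w - Ψc 0 w‖ + ‖Ψc 0 w - Ac w‖ :=
          norm_sub_le_norm_sub_add_norm_sub _ _ _
      _ ≤ C * |g| * (|g| + ‖w‖) + C * ‖w‖ ^ 2 := add_le_add h2 h3
      _ = C * (|g| * |g| + |g| * ‖w‖ + ‖w‖ ^ 2) := by ring
      _ ≤ C * (2 * (|g| * |g| + ‖w‖ ^ 2)) := by
          gcongr C * ?_
          nlinarith [sq_nonneg (|g| - ‖w‖), mul_nonneg (abs_nonneg g) (norm_nonneg w)]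
      _ = 2 * C * (g ^ 2 + ‖w‖ ^ 2) := by rw [← sq, sq_abs]; ring
      _ ≤ (8 * C + C / a) * (g ^ 2 + ‖w‖ ^ 2) := by gcongr; linarith
  · intro g w w' hg hw hw'
    obtain ⟨hdφ, hdΨ⟩ := hfib g hg
    constructor
    · have hKb : ∀ ζ : F, ‖ζ‖ ≤ 3 * δ →
          ‖φc g ζ - ((g + b * g ^ 3 : ℝ) : ℂ)‖ ≤ 4 * C * δ * |g| ^ 3 := fun ζ hζ =>
        calc ‖φc g ζ - ((g + b * g ^ 3 : ℝ) : ℂ)‖ ≤ C * (g ^ 4 + |g| ^ 3 * ‖ζ‖) :=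
              (hsup g hg ζ hζ).1
          _ = C * (|g| ^ 3 * (|g| + ‖ζ‖)) := by rw [pow_four_eq_abs_pow_four]; ring
          _ ≤ C * (|g| ^ 3 * (δ + 3 * δ)) := by gcongr
          _ = 4 * C * δ * |g| ^ 3 := by ring
      have key : ‖(φc g w - ((g + b * g ^ 3 : ℝ) : ℂ)) - (φc g w' - ((g + b * g ^ 3 : ℝ) : ℂ))‖ ≤
          4 * C * δ * |g| ^ 3 / (2 * δ) * ‖w - w'‖ :=
        norm_sub_le_of_ball_sup hδ (hdφ.sub_const _) hKb hw hw'
      rw [sub_sub_sub_cancel_right] at key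
      calc ‖φc g w - φc g w'‖ ≤ 4 * C * δ * |g| ^ 3 / (2 * δ) * ‖w - w'‖ := key
        _ = 2 * C * |g| ^ 3 * ‖w - w'‖ := by field_simp; ring
        _ ≤ (8 * C + C / a) * |g| ^ 3 * ‖w - w'‖ := by gcongr; linarith
    · have hb : ∀ ζ : F, ‖ζ‖ ≤ 3 * δ →
          ‖Ψc g ζ - Ac ζ‖ ≤ C * |g| * (|g| + ‖ζ‖) + C * ‖ζ‖ ^ 2 := fun ζ hζ => by
        obtain ⟨-, h2, h3⟩ := hsup g hg ζ hζ
        exact (norm_sub_le_norm_sub_add_norm_sub _ _ _).trans (add_le_add h2 h3)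
      have key : ‖(Ψc g w - Ac w) - (Ψc g w' - Ac w')‖ ≤
          8 * C * (|g| + ‖w‖ + ‖w'‖) * ‖w - w'‖ :=
        norm_sub_le_of_quadratic_sup hδ hC0 (abs_nonneg g) hg (hdΨ.sub Ac.differentiableOn) hb
          hw hw'
      calc ‖Ψc g w - Ψc g w' - Ac (w - w')‖ = ‖(Ψc g w - Ac w) - (Ψc g w' - Ac w')‖ := by
            rw [map_sub]; abel_nf
        _ ≤ 8 * C * (|g| + ‖w‖ + ‖w'‖) * ‖w - w'‖ := key
        _ ≤ (8 * C + C / a) * (|g| + ‖w‖ + ‖w'‖) * ‖w - w'‖ := by gcongr; linarith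
  · intro g g' w hg hg' hw
    obtain ⟨D1, D2, D3, D4⟩ := hcoup w hw
    have hw3 : ‖w‖ ≤ 3 * δ := by linarith [norm_nonneg w]
    have ha0 : a ≠ 0 := ha.ne'
    -- Cauchy estimates in the coupling at real `t ≠ 0`: sector discs for `ρ₁s, Ψs`, horn discs
    -- for `ρ₁l, Ψl`
    have hpieces : ∀ t : ℝ, t ≠ 0 → |t| ≤ δ →
        (DifferentiableAt ℂ (fun z => ρ₁s z w) t ∧
          ‖deriv (fun z => ρ₁s z w) t‖ ≤ C / a * |t| ^ 2 * (|t| + ‖w‖)) ∧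
        (DifferentiableAt ℂ (fun z => ρ₁l z w) t ∧
          ‖deriv (fun z => ρ₁l z w) t‖ ≤ C * |t| ^ 2 * (|t| + ‖w‖)) ∧
        (DifferentiableAt ℂ (fun z => Ψs z w) t ∧
          ‖deriv (fun z => Ψs z w) t‖ ≤ C / a * (|t| + ‖w‖)) ∧
        (DifferentiableAt ℂ (fun z => Ψl z w) t ∧
          ‖deriv (fun z => Ψl z w) t‖ ≤ C * (|t| + ‖w‖)) := by
      intro t ht htδ
      obtain ⟨hρt, hsU, hlU⟩ := hdiscs t ht htδ
      obtain ⟨hta, hρ0⟩ : |t| ≠ 0 ∧ ρ t ≠ 0 := ⟨abs_ne_zero.mpr ht, hρt.ne'⟩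
      have hat : 0 < a * |t| := mul_pos ha (abs_pos.mpr ht)
      have e1 := differentiableAt_and_norm_deriv_le hU D1 hat hsU
        (fun z hz => (hsec t ht htδ z hz w hw).1)
      have e2 := differentiableAt_and_norm_deriv_le hU D2 hρt hlU
        (fun z hz => (hhorn t ht htδ z hz w hw).1)
      have e3 := differentiableAt_and_norm_deriv_le hU D3 hat hsU
        (fun z hz => (hsec t ht htδ z hz w hw).2)
      have e4 := differentiableAt_and_norm_deriv_le hU D4 hρt hlU
        (fun z hz => (hhorn t ht htδ z hz w hw).2)
      refine ⟨⟨e1.1, e1.2.trans_eq ?_⟩, ⟨e2.1, e2.2.trans_eq ?_⟩, ⟨e3.1, e3.2.trans_eq ?_⟩,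
        ⟨e4.1, e4.2.trans_eq ?_⟩⟩
      · rw [pow_four_eq_abs_pow_four]; field_simp
      · rw [← sq_abs t]; field_simp
      · field_simp
      · field_simp
    constructor
    · -- the `φ`-part: `P z = ρ₁s z w + ρ₁l z w = φc z w - z - b z³`, `P 0 = 0`
      obtain ⟨P, hP⟩ : ∃ P : ℂ → ℂ, P = fun z => ρ₁s z w + ρ₁l z w := ⟨_, rfl⟩
      have hPφ : ∀ t : ℝ, P t = φc t w - ((t + b * t ^ 3 : ℝ) : ℂ) := fun t => by
        rw [hP, hφ]; push_cast; ring
      have hP0 : P 0 = 0 := by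
        have h := hPφ 0; simp only [Complex.ofReal_zero] at h; rw [h, hφ0 w hw3]; simp
      have hderivP : ∀ t : ℝ, t ≠ 0 → |t| ≤ δ →
          DifferentiableAt ℂ P t ∧ ‖deriv P t‖ ≤ (C / a + C) * |t| ^ 2 * (|t| + ‖w‖) := by
        intro t ht htδ
        obtain ⟨⟨d1, b1⟩, ⟨d2, b2⟩, -, -⟩ := hpieces t ht htδ
        rw [hP]; refine ⟨d1.fun_add d2, ?_⟩; rw [deriv_fun_add d1 d2]
        calc _ ≤ ‖deriv (fun z => ρ₁s z w) t‖ + ‖deriv (fun z => ρ₁l z w) t‖ := norm_add_le _ _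
          _ ≤ C / a * |t| ^ 2 * (|t| + ‖w‖) + C * |t| ^ 2 * (|t| + ‖w‖) := add_le_add b1 b2
          _ = (C / a + C) * |t| ^ 2 * (|t| + ‖w‖) := by ring
      have hendP : ∀ t : ℝ, |t| ≤ δ →
          ‖P t - P 0‖ ≤ (C / a + C) * |t| ^ 2 * (|t| + ‖w‖) * |t| := by
        intro t htδ
        rw [hP0, sub_zero, hPφ]
        calc ‖φc t w - ((t + b * t ^ 3 : ℝ) : ℂ)‖ ≤ C * (t ^ 4 + |t| ^ 3 * ‖w‖) :=
              (hsup t htδ w hw3).1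
          _ = C * |t| ^ 2 * (|t| + ‖w‖) * |t| := by rw [pow_four_eq_abs_pow_four]; ring
          _ ≤ (C / a + C) * |t| ^ 2 * (|t| + ‖w‖) * |t| := by gcongr
      have key := norm_sub_le_of_real_couplings (by positivity) (norm_nonneg w) hderivP hendP hg hg'
      calc ‖φc g w - φc g' w - (((g - g') + b * (g ^ 3 - g' ^ 3) : ℝ) : ℂ)‖ = ‖P g - P g'‖ := by
            rw [hPφ, hPφ]; congr 1; push_cast; ring
        _ ≤ (C / a + C) * max |g| |g'| ^ 2 * (max |g| |g'| + ‖w‖) * |g - g'| := key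
        _ ≤ (8 * C + C / a) * max |g| |g'| ^ 2 * (max |g| |g'| + ‖w‖) * |g - g'| := by gcongr
    · -- the `Ψ`-part: `Q z = Ψc z w = Ψs z w + Ψl z w`
      obtain ⟨Q, hQ⟩ : ∃ Q : ℂ → F, Q = fun z => Ψc z w := ⟨_, rfl⟩
      have hQ' : Q = fun z => Ψs z w + Ψl z w := by rw [hQ]; funext z; exact hΨ z w
      have hderivQ : ∀ t : ℝ, t ≠ 0 → |t| ≤ δ →
          DifferentiableAt ℂ Q t ∧ ‖deriv Q t‖ ≤ (C / a + C) * |t| ^ 0 * (|t| + ‖w‖) := by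
        intro t ht htδ
        obtain ⟨-, -, ⟨d3, b3⟩, ⟨d4, b4⟩⟩ := hpieces t ht htδ
        rw [hQ']; refine ⟨d3.fun_add d4, ?_⟩; rw [deriv_fun_add d3 d4]
        calc _ ≤ ‖deriv (fun z => Ψs z w) t‖ + ‖deriv (fun z => Ψl z w) t‖ := norm_add_le _ _
          _ ≤ C / a * (|t| + ‖w‖) + C * (|t| + ‖w‖) := add_le_add b3 b4
          _ = (C / a + C) * |t| ^ 0 * (|t| + ‖w‖) := by ring
      have hendQ : ∀ t : ℝ, |t| ≤ δ →
          ‖Q t - Q 0‖ ≤ (C / a + C) * |t| ^ 0 * (|t| + ‖w‖) * |t| := by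
        intro t htδ
        rw [hQ]
        calc ‖Ψc t w - Ψc 0 w‖ ≤ C * |t| * (|t| + ‖w‖) := (hsup t htδ w hw3).2.1
          _ ≤ (C / a + C) * |t| * (|t| + ‖w‖) := by gcongr
          _ = (C / a + C) * |t| ^ 0 * (|t| + ‖w‖) * |t| := by ring
      have key := norm_sub_le_of_real_couplings (by positivity) (norm_nonneg w) hderivQ hendQ hg hg'
      have hm : max |g| |g'| ≤ |g| + |g'| := max_le_add_of_nonneg (abs_nonneg _) (abs_nonneg _)
      calc ‖Ψc g w - Ψc g' w‖ = ‖Q g - Q g'‖ := by rw [hQ]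
        _ ≤ (C / a + C) * max |g| |g'| ^ 0 * (max |g| |g'| + ‖w‖) * |g - g'| := key
        _ = (C / a + C) * (max |g| |g'| + ‖w‖) * |g - g'| := by ring
        _ ≤ (8 * C + C / a) * (|g| + |g'| + ‖w‖) * |g - g'| := by gcongr

end Summit.QuantumFields.YangMills.Theorems.BalabanStepParabolic

end
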